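import Summits.BirchSwinnertonDyer.BirchSwinnertonDyer.Theorems.ByReductionTypeAtTwoSupersingularFlatKernelBidual
import Literature.Algebra.Module.PadicPairingFamilies
import Literature.Algebra.Module.PadicFunctionalSeparation
import Mathlib.Algebra.Module.CharacterModule
import HarnessLib

/-!
# `(E♭_{∞,𝔭})_Γ = 0`: Sprung's ♭-local condition — the exact annihilator of `Ker Col♭` — is
# `(γ − 1)`-DIVISIBLE (any `p`, explicit Honda clauses; the `p = 2` port of the ♭-local lift LOC♭, part 18)

Seat `bsd-2adic-ss-1` GEN 13, crux `SupersingularRankZeroAtTwo` (item stmt-BirchSwinnertonDyer-19097, route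
`ByReductionTypeAtTwo`, rung K4), line `flat_uniform_two` v1, stub (2) `stub_allFlatData`, conjunct COUNT♭@2,
displayed input `hloc2` (LOC♭) of the door `SSFlatEC.flatCountTwo_of_print_of_loc2` (part 15). Sequel of parts
16–17 (`…FlatKernelClosed`, `…FlatKernelBidual`: `K := Ker Col♭` is twist-saturated, closed, and `K^⊥⊥ = K`).

In the transcription of `Sprung2012/ColemanMaps.lean` (`H¹_Iw(T) = 𝓗 := Hom(M, ℤ_p)`, `M = E(K_∞·K_v)`, local
Tate pairing of `z` with the Kummer class of `x ⊗ p^{-k}` = `z(x)/p^k mod ℤ_p`), Sprung's `E♭_{∞,𝔭}` (Def. 7.9: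
"the exact annihilator of `Ker Col♭`") is the set of `x ⊗ p^{-k}`, `x ∈ M`, with `p^k ∣ z(x)` for all `z ∈ K`.
THIS FILE proves its **`(γ − 1)`-divisibility** (`flatAnnihilator_twist_divisible`): for every such `(x, k)`
there are `(x', k')` of the same kind and `m ∈ M` with
`p^{k'} x − p^k (g⁻¹x' − x') = p^{k+k'} m`, i.e. `x ⊗ p^{-k} = (g⁻¹ − 1)(x' ⊗ p^{-k'})` in `M ⊗ ℚ_p/ℤ_p` — the
statement «`(E♭_∞)_Γ = 0`» (coinvariants of a discrete `Γ`-module vanish ⟺ `γ − 1` is onto). Proof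
(Pontryagin duality, all in the kernel): model `M ⊗ ℚ_p/ℤ_p` by the subgroup `D ⊆ Hom(𝓗, ℚ/ℤ)` of pairing
characters `e x k = (z ↦ z(x)/p^k)` (`Literature.Algebra.Module.exists_padicPairingFamily`), `E♭` by
`L = D ∩ Ann(K)`, `γ` by `A d = d ∘ (z ↦ z ∘ g⁻¹)`; if `A − 1` were not onto `L`, a character `χ ≠ 0` of
`L/(A−1)L` extends to `D` (`ℚ/ℤ` injective, `CharacterModule.dual_surjective_of_injective`) and is the evaluation
at some `w ∈ 𝓗` (biduality `exists_eval_eq_of_character_padicPairingFamily`); `χ ∘ (A − 1) = 0` says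
`w ∘ g⁻¹ − w ∈ L^⊥ = K^⊥⊥ = K` (part 17), so `w ∈ K` (twist-saturation, part 16), so `χ = 0`. The pair form
follows by Pontryagin SEPARATION (`exists_nsmul_eq_of_forall_addMonoidHom_padicInt_dvd`; `M` has no `p`-torsion
— Sprung 2012 Lemma 2.3, displayed as `hnt`; at `p = 2` it is the tree theorem
`eq_zero_of_mem_localTowerPointsOfEmb_of_two_nsmul`).
HONEST TAG after this file: LOC♭ = THEOREM {`(E♭_∞)_Γ = 0` (parts 16–18)} ∘ KERNEL-ABLE-NOT-DONE {local
`cd_p Γ_𝔭 = 1` (`ZpExtension.mem_range_resOfLe_of_conjH1_eq` for the local `ℤ_p`-extension) + the Kummer-cocycle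
plumbing into the exact shape of `hloc2`}. Nothing about any curve is asserted; no census cell moves; BSD is not
proved by any of this.

References: [Sprung2012] F. Sprung, J. Number Theory 132 (2012), Def. 7.9, Lemma 7.10, Def. 7.11 (p. 1503),
Prop. 5.7 (p. 1495), §2 p. 1486 (`γ ↦ 1 + X`); [GreenbergLNM1716] §4 proof of Lemma 4.7, p. 108;
[NeukirchSchmidtWingberg2008] I §1 (1.1.8).
-/

set_option autoImplicit false
-- the Theorems namespace of this sub repeats the summit name by design (D-0017 nested layout)
set_option linter.dupNamespace false

noncomputable section

open scoped Classical NumberField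

open NumberField IsDedekindDomain Polynomial WeierstrassCurve Literature.NumberTheory.EllipticCurves
  Literature.NumberTheory.GaloisRepresentations Literature.NumberTheory.EllipticCurves.ZpExtension
  Literature.NumberTheory.EllipticCurves.Kobayashi2003 Literature.NumberTheory.EllipticCurves.Sprung2017
  Literature.NumberTheory.EllipticCurves.Sprung2012 Literature.Algebra.Module

universe u

namespace Summit.BirchSwinnertonDyer.BirchSwinnertonDyer.Theorems.SSFlatEC

variable {K : Type u} [Field K] {p : ℕ} [Fact p.Prime] (κ : ZpExtension K p)
variable {E : Type u} [Field E] [Algebra K E] (ι : AlgebraicClosure K →ₐ[K] AlgebraicClosure E)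
variable (W : WeierstrassCurve K)

/-- **`(E♭_{∞,𝔭})_Γ = 0` in pair form.** Let `M = E(K_∞·K_v)` (no `p`-torsion), `K = Ker Col♭ ⊆ Hom(M, ℤ_p)` for
local data `(g, c)` (`p ∣ a_p`, `g` restricting to a topological generator, levels, `n ≥ 1` trace relation). If
`(x, k)` is annihilated by `K` (`p^k ∣ z(x)` for all `z ∈ K` — the class `x ⊗ p^{-k}` lies in `E♭_{∞,𝔭}`), then
there are `(x', k')` annihilated by `K` and `m ∈ M` with `p^{k'}·x − p^k·(g⁻¹x' − x') = p^{k+k'}·m` — i.e.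
`x ⊗ p^{-k} = (g⁻¹ − 1)·(x' ⊗ p^{-k'})` in `M ⊗ ℚ_p/ℤ_p`: the `Γ`-coinvariants of `E♭_{∞,𝔭}` vanish. (Pontryagin
dual of `((E♭_∞)^∨)^Γ = (𝓗/K)^{γ} ↪ Λ^{(1+T)·=·} = 0`; module docstring for the proof.)
[cite: Sprung2012, Def. 7.9, Lemma 7.10 (p. 1503), Prop. 5.7 (p. 1495), §2 p. 1486]
[cite: NeukirchSchmidtWingberg2008, I §1 (1.1.8) (Pontryagin duality)] -/
theorem flatAnnihilator_twist_divisible {ap : ℤ} (hap : (p : ℤ) ∣ ap)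
    {g : Field.absoluteGaloisGroup E} (hg : κ.IsTopGenerator (resGalOfEmb ι g))
    {c : ℕ → localPoints W E} (hc : ∀ n, c n ∈ localLayerPointsOfEmb κ ι W n)
    (hTr : ∀ n, 1 ≤ n → localTraceOfEmb κ ι W n (n + 1) (c (n + 1)) = ap • c n - c (n - 1))
    (hnt : ∀ P ∈ localTowerPointsOfEmb κ ι W, p • P = 0 → P = 0)
    (x : localTowerPointsOfEmb κ ι W) (k : ℕ)
    (hx : ∀ z ∈ colemanKer κ ι W ap g c .flat, (p : ℤ_[p]) ^ k ∣ z x) :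
    ∃ (x' : localTowerPointsOfEmb κ ι W) (k' : ℕ) (m : localTowerPointsOfEmb κ ι W),
      (∀ z ∈ colemanKer κ ι W ap g c .flat, (p : ℤ_[p]) ^ k' ∣ z x') ∧
      p ^ k' • x - p ^ k • ((⟨g⁻¹ • (x' : localPoints W E), smul_mem_localTowerPointsOfEmb κ ι W g⁻¹ x'.2⟩ :
          localTowerPointsOfEmb κ ι W) - x') = p ^ (k + k') • m := by
  -- notation: `ℳ = E(K_∞·K_v)`, `𝓗 = Hom(ℳ, ℤ_p)`, the kernel `Kf = Ker Col♭`
  set Kset : Set (localTowerPointsOfEmb κ ι W →+ ℤ_[p]) := colemanKer κ ι W ap g c .flat with hKset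
  -- the twist `σ : y ↦ g⁻¹ y` on `ℳ`, `τ : z ↦ z ∘ σ` on `𝓗`
  let σ : localTowerPointsOfEmb κ ι W →+ localTowerPointsOfEmb κ ι W :=
    { toFun := fun y ↦ ⟨g⁻¹ • (y : localPoints W E), smul_mem_localTowerPointsOfEmb κ ι W g⁻¹ y.2⟩
      map_zero' := Subtype.ext (by simp)
      map_add' := fun a b ↦ Subtype.ext (by simp [smul_add]) }
  have hσ : ∀ y : localTowerPointsOfEmb κ ι W,
      σ y = ⟨g⁻¹ • (y : localPoints W E), smul_mem_localTowerPointsOfEmb κ ι W g⁻¹ y.2⟩ := fun _ ↦ rfl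
  let τ : (localTowerPointsOfEmb κ ι W →+ ℤ_[p]) →+ (localTowerPointsOfEmb κ ι W →+ ℤ_[p]) :=
    AddMonoidHom.compHom' σ
  have hτ : ∀ (z : localTowerPointsOfEmb κ ι W →+ ℤ_[p]) (y : localTowerPointsOfEmb κ ι W),
      τ z y = z ⟨g⁻¹ • (y : localPoints W E), smul_mem_localTowerPointsOfEmb κ ι W g⁻¹ y.2⟩ := fun _ _ ↦ rfl
  -- `K` is twist-stable and twist-saturated (part 16)
  have hKτ : ∀ z ∈ Kset, τ z ∈ Kset := fun z hz ↦
    (mem_colemanKer_flat_twist_iff κ ι W hap hg hc hTr (z := z) (z' := τ z) (hτ z)).mpr hz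
  have hKsat : ∀ z, τ z - z ∈ Kset → z ∈ Kset := fun z hz ↦
    mem_colemanKer_flat_of_twist_sub_mem κ ι W hap hg hc hTr (z := z) (z' := τ z) (hτ z) hz
  -- the pairing characters `e y j = (z ↦ z(y)/p^j)` and their group `D ≅ ℳ ⊗ ℚ_p/ℤ_p`
  obtain ⟨e, he⟩ := exists_padicPairingFamily (N := localTowerPointsOfEmb κ ι W) (p := p)
  obtain ⟨D, hD⟩ := exists_addSubgroup_padicPairingFamily he
  have heD : ∀ y j, e y j ∈ D := fun y j ↦ (hD _).mpr ⟨y, j, rfl⟩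
  have he0 : ∀ y j z, e y j z = 0 ↔ (p : ℤ_[p]) ^ j ∣ z y := fun y j z ↦ padicPairingFamily_apply_eq_zero_iff he y j z
  -- the twist `A d = d ∘ τ` on characters, `A (e y j) = e (σ y) j`
  let A : ((localTowerPointsOfEmb κ ι W →+ ℤ_[p]) →+ AddCircle (1 : ℚ)) →+
      ((localTowerPointsOfEmb κ ι W →+ ℤ_[p]) →+ AddCircle (1 : ℚ)) := AddMonoidHom.compHom' τ
  have hA : ∀ d z, A d z = d (τ z) := fun _ _ ↦ rfl
  have hAe : ∀ y j, A (e y j) = e (σ y) j := by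
    intro y j
    ext z
    obtain ⟨a, ha⟩ := ZMod.intCast_surjective (PadicInt.toZModPow j (z (σ y)))
    rw [hA, he y j (τ z) a (by rw [hτ, ← hσ, ha]), he (σ y) j z a ha.symm]
  -- `L = D ∩ Ann(K)` (= `E♭_{∞,𝔭}`), stable under `A`
  let Ann : AddSubgroup ((localTowerPointsOfEmb κ ι W →+ ℤ_[p]) →+ AddCircle (1 : ℚ)) :=
    { carrier := setOf fun d ↦ ∀ z ∈ Kset, d z = 0
      zero_mem' := fun _ _ ↦ rfl
      add_mem' := fun ha hb z hz ↦ by rw [AddMonoidHom.add_apply, ha z hz, hb z hz, add_zero]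
      neg_mem' := fun ha z hz ↦ by rw [AddMonoidHom.neg_apply, ha z hz, neg_zero] }
  have hAnn : ∀ d, d ∈ Ann ↔ ∀ z ∈ Kset, d z = 0 := fun _ ↦ Iff.rfl
  let L : AddSubgroup ((localTowerPointsOfEmb κ ι W →+ ℤ_[p]) →+ AddCircle (1 : ℚ)) := D ⊓ Ann
  have hL : ∀ d, d ∈ L ↔ d ∈ D ∧ ∀ z ∈ Kset, d z = 0 := fun _ ↦ AddSubgroup.mem_inf
  have hAL : ∀ d ∈ L, A d - d ∈ L := by
    intro d hd
    obtain ⟨hdD, hdK⟩ := (hL d).mp hd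
    obtain ⟨y, j, rfl⟩ := (hD _).mp hdD
    refine (hL _).mpr ⟨?_, fun z hz ↦ ?_⟩
    · rw [hAe]; exact D.sub_mem (heD _ _) (heD _ _)
    · rw [AddMonoidHom.sub_apply, hA, hdK _ (hKτ z hz), hdK z hz, sub_zero]
  let B : L →+ L :=
    { toFun := fun d ↦ ⟨A d - d, hAL d d.2⟩
      map_zero' := Subtype.ext (by simp)
      map_add' := fun a b ↦ Subtype.ext (by
        simp only [AddSubgroup.coe_add, map_add]
        abel) }
  have hB : ∀ d : L, ((B d : L) : (localTowerPointsOfEmb κ ι W →+ ℤ_[p]) →+ AddCircle (1 : ℚ)) = A d - d :=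
    fun _ ↦ rfl
  -- KEY: `B = A − 1` is onto `L` («`(E♭_∞)_Γ = 0`», dual form)
  have hBsurj : Function.Surjective B := by
    rw [← AddMonoidHom.range_eq_top, AddSubgroup.eq_top_iff']
    intro d₀
    by_contra hd₀
    -- a character of `L/(A−1)L` non-zero at `d₀`, pulled back to `L`
    have hne : (QuotientAddGroup.mk d₀ : L ⧸ B.range) ≠ 0 := by
      rwa [Ne, QuotientAddGroup.eq_zero_iff]
    obtain ⟨χq, hχq⟩ := CharacterModule.exists_character_apply_ne_zero_of_ne_zero hne
    let χ : L →+ AddCircle (1 : ℚ) := (χq : (L ⧸ B.range) →+ AddCircle (1 : ℚ)).comp (QuotientAddGroup.mk' B.range)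
    have hχB : ∀ d : L, χ (B d) = 0 := by
      intro d
      change (χq : (L ⧸ B.range) →+ AddCircle (1 : ℚ)) (QuotientAddGroup.mk' B.range (B d)) = 0
      rw [QuotientAddGroup.mk'_apply, (QuotientAddGroup.eq_zero_iff _).mpr (AddMonoidHom.mem_range.mpr ⟨d, rfl⟩),
        map_zero]
    have hχd₀ : χ d₀ ≠ 0 := hχq
    -- extend `χ` to `D` (`ℚ/ℤ` injective) and represent it by `w ∈ 𝓗` (biduality)
    let incl : L →+ D := AddSubgroup.inclusion inf_le_left
    obtain ⟨Φ, hΦ⟩ := CharacterModule.dual_surjective_of_injective incl.toIntLinearMap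
      (AddSubgroup.inclusion_injective inf_le_left) χ
    have hΦχ : ∀ d : L, Φ (incl d) = χ d := fun d ↦ by
      rw [← hΦ]; rfl
    obtain ⟨w, hw⟩ := exists_eval_eq_of_character_padicPairingFamily he hD Φ
    -- `χ ∘ B = 0` ⇒ every `d ∈ L` kills `τ w − w`
    have hkill : ∀ d ∈ L, d (τ w - w) = 0 := by
      intro d hd
      have h := hχB ⟨d, hd⟩
      rw [← hΦχ] at h
      have h2 : ((incl (B ⟨d, hd⟩) : D) : (localTowerPointsOfEmb κ ι W →+ ℤ_[p]) →+ AddCircle (1 : ℚ)) w = 0 :=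
        (hw _).symm.trans h
      change (A d - d) w = 0 at h2
      rwa [AddMonoidHom.sub_apply, hA, ← map_sub] at h2
    -- hence `τ w − w ∈ K^⊥⊥ = K` (part 17) and `w ∈ K` (part 16)
    have hτw : τ w - w ∈ Kset := by
      refine mem_colemanKer_flat_of_forall_annihilator_dvd κ ι W hap hg hc hTr _ fun y j hyj ↦ ?_
      have hyL : e y j ∈ L := (hL _).mpr ⟨heD y j, fun z hz ↦ (he0 y j z).mpr (hyj z hz)⟩
      exact (he0 y j _).mp (hkill _ hyL)
    have hwK : w ∈ Kset := hKsat w hτw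
    -- so `χ = 0` on `L`: contradiction
    apply hχd₀
    rw [← hΦχ]
    exact (hw _).trans (((hL _).mp d₀.2).2 w hwK)
  -- apply to `d₀ = e x k ∈ L`
  have hxL : e x k ∈ L := (hL _).mpr ⟨heD x k, fun z hz ↦ (he0 x k z).mpr (hx z hz)⟩
  obtain ⟨d', hd'⟩ := hBsurj ⟨e x k, hxL⟩
  have hd'eq : A (d' : (localTowerPointsOfEmb κ ι W →+ ℤ_[p]) →+ AddCircle (1 : ℚ)) - d' = e x k := by
    rw [← hB, hd']
  obtain ⟨hd'D, hd'K⟩ := (hL _).mp d'.2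
  obtain ⟨x', k', hx'⟩ := (hD _).mp hd'D
  refine ⟨x', k', ?_⟩
  have hann : ∀ z ∈ Kset, (p : ℤ_[p]) ^ k' ∣ z x' := fun z hz ↦ (he0 x' k' z).mp (by rw [← hx']; exact hd'K z hz)
  -- `e (σ x' − x') k' = e x k`, rescaled to the common level `k + k'`
  rw [hx', hAe] at hd'eq
  have hsub : e (σ x') k' - e x' k' = e (σ x' - x') k' := by
    rw [sub_eq_add_neg, ← padicPairingFamily_neg_left he, ← padicPairingFamily_add_left he, ← sub_eq_add_neg]
  rw [hsub] at hd'eq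
  have hlev : e (p ^ k • (σ x' - x')) (k + k') = e (p ^ k' • x) (k + k') := by
    rw [padicPairingFamily_pow_nsmul_left he, hd'eq, add_comm k k', padicPairingFamily_pow_nsmul_left he]
  rw [padicPairingFamily_eq_iff he] at hlev
  -- Pontryagin separation in `ℳ` (no `p`-torsion)
  have hN : ∀ y : localTowerPointsOfEmb κ ι W, p • y = 0 → y = 0 := fun y hy ↦
    Subtype.ext (hnt _ y.2 (by rw [← AddSubgroupClass.coe_nsmul, hy]; rfl))
  have hdvd : ∀ z : localTowerPointsOfEmb κ ι W →+ ℤ_[p],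
      (p : ℤ_[p]) ^ (k + k') ∣ z (p ^ k' • x - p ^ k • (σ x' - x')) := fun z ↦ by
    rw [← neg_sub, map_neg, dvd_neg]; exact hlev z
  obtain ⟨m, hm⟩ := exists_nsmul_eq_of_forall_addMonoidHom_padicInt_dvd hN hdvd
  refine ⟨m, hann, ?_⟩
  change p ^ k' • x - p ^ k • (σ x' - x') = p ^ (k + k') • m
  rw [hm]

end Summit.BirchSwinnertonDyer.BirchSwinnertonDyer.Theorems.SSFlatEC

end
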